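import Literature.NumberTheory.Automorphic.ArchInnerFormChartOrbitalSmoothWalls         -- ★ p850547 (F0P3a-p05 (g20)): `uniformlyProper_gprimeBlock_of_inRegG_place`, `uniformlyProper_gprimeTorus_chartTorusG_inRegG`, `uniformlyProper_of_isCompact_subgroup`; brings ★ SPLIT-DOCK p850470, ★ D4b-1β, ★ D4b-1, ★ D4a
import Literature.NumberTheory.Automorphic.ArchInnerFormSemiregularCentralizerBlockCayley  -- ★ p850544 (M-UNFOLD) (u2) on the Cayley chart: `gprimeBlock_insert_of_ne`, `gprimeTorus_insert_mem_centralizer`; brings ★ `gprimeBlock_congr_place`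
import Literature.NumberTheory.Rogawski1990.ArchChartOrbGBlockCayRayBinders                 -- ★ p850485-lineage (F0P3-p02 (g18)): `cexp_mul_I_ne_boostPair`, `gprimeTorus_insert_hcCayPt_eq`; brings ★ `integrable_descConj_of_exists_isCompact`, ★ `chartQuotientMeasureG`, ★ `hcCayPt`
import Literature.NumberTheory.Automorphic.ArchInnerFormCartanAtlasRegular                -- ★ `injective_boostEig_iff`
import HarnessLib

/-!
# The (SPLIT-DOCK) at a real wall of a split chart WITH COMPACT WALLS AT THE OTHER PLACES: Harish-Chandra's compactness lemma modulo `Z(γ_p)` on `InRegG`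
# ((G2) «real wall × compact walls»; Rogawski 1990 §4.12 Lemma 4.12.1, §8.2 pp. 114, 122–123; Harish-Chandra–van Dijk 1970 I §3 Lemma 22; Varadarajan 1977 I §1.12)

Topic `NumberTheory/Rogawski1990`; namespace `Literature.NumberTheory.Rogawski1990`.  THEOREMS ONLY (no `def`, no instance, no notation, no axiom, no named fact, no `sorry`);
kernel lane `--kind proof --supports stmt-HodgeConjecture-24833`.  Cell `pub/hodgecm-mathlib`, crux H413 (`stmt-HodgeConjecture-24833`), F0∕P3c line LH3 (closer stub
`stub_N9`), LETTER L1 `HcOrbitalFamiliesStatement`, clause (I₂) «`orbFamGExt ν′ a′ S′` is `C^∞` on `InRegG s S′`» — brick **(G2) «REAL WALL × COMPACT WALLS DOCK»** of F0P3b-p01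
(g16)'s census `CENSUS-I2-corners.v1.md` §1 (LH3-plan (g3) LETTER-L1 (I₂) BOARD 2026-09-02T09:25:44Z, deal (iii) → LH10-p02 (g5); owners F0P3a-p05 (g20) ∕ F0P3b-p01 (g16)).

THE MATHEMATICS.  The (B)∕(B∞) dress of the real wall `x_{w₀} = 0` of the split chart `S♯ = S ∪ {w₀}` (★ p850625 `continuousOn_orbFamGExt_realWall_descended_of_cutoff`, ★ p850781
`contDiffOn_orbFamGExt_realWall_of_block_of_smooth`) reads two binders OFF the wall on an open `U`: the docking `hCM` («`y′ γ_c y′⁻¹ ∈ tsupport a′ ⇒ y′ ∈ C″ · Z(s)`», ONE compact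
`C″`, `s = γ_p = gprimeTorus S p` the wall point on the compact chart, ★ `gprimeTorus_of_wall`) and the integrability `hint` of the chart integrand.  So far they were discharged at the
organ-J Cayley points only (★ `exists_cayRay_binders`: the `x`-ray through `hcCayPt p`, `p` SEMIREGULAR — regular at every other place, ★ SPLIT-DOCK
`uniformlyProper_gprimeTorus_of_semireg_split_of_regular` with INJECTIVE angles at the compact-chart places).  This file removes the restriction at the compact-chart places:
the atlas `c ↦ gprimeTorus S♯ c` is uniformly proper modulo `Z(γ_p)` on the OPEN set
  `V = {c | (x_{w₀} = 0 → e^{iθ_{w₀}} ≠ e^{iφ_{w₀}}) ∧ (∀ w ∈ S, x_w ≠ 0) ∧ c ∈ InRegG (slotSign α) S♯}`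
— across the real wall at `w₀`, across every COMPACT wall (two same-sign slots colliding at an indefinite compact-chart place `w ∉ S♯`) and through every point of a definite
place.  Per place: at `w₀` ★ D4b-1β `uniformlyProper_gprimeBlock_split_of_ne` modulo `Stab(e_{τ1}) ≤ Z(block of p)` (the compact-line eigenvalue `e^{iφ}` stays simple on `V`:
`e^{iφ} ≠ e^{±x+iθ}` is automatic for `x ≠ 0`, ★ `injective_boostEig_iff`, and is the semiregularity for `x = 0`, ★ `cexp_mul_I_ne_boostPair`); at every other place ★ p850547
`uniformlyProper_gprimeBlock_of_inRegG_place` for the REGULAR reference point `c₁ := p` off `w₀` (at a compact wall the stabiliser of the odd line is COMPACT, ★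
`isCompact_stabilizer_single_of_sameSign`, and (HYP) modulo a compact subgroup is (HYP) modulo anything, ★ `uniformlyProper_of_isCompact_subgroup`), transported to the modulus
`Z(gprimeBlock S p)` (★ `gprimeBlock_insert_of_ne`, ★ `gprimeBlock_congr_place`); assembly ★ D4a `uniformlyProper_arch_of_places` with `Z(γ_p) ↔ Π_w Z(gprimeBlock_w p)`.
* §1 `boostEig_one_ne_of_wall_imp` (the simple eigenvalue on `V`), `isOpen_setOf_wall_imp_inter_inRegG` (`V` is open);
* §2 **`uniformlyProper_gprimeTorus_insert_of_wall_inRegG`** ((HYP) on `V` modulo `Z(γ_p)`), **`exists_isCompact_mul_gprimeTorus_insert_of_wall_inRegG`** (group level: ONE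
  compact `C″` for a compact `K ⊆ V`);
* §3 **`integrable_descConj_gprimeTorus_of_inRegG`** (the `hint` binder at every point of `{∀ w ∈ S′, x_w ≠ 0} ∩ InRegG`, any admissible `S′`: ★ p850547
  `uniformlyProper_gprimeTorus_chartTorusG_inRegG` at one point + ★ D3 §1 `integrable_descConj_of_exists_isCompact`);
* §4 the docks: **`exists_nhds_realWall_dock`** (in (M-UNFOLD)'s currency `p, hp, hreg, hregS`: every `p₀ ∈ V` has an open `U ∋ p₀`, `U ⊆ V`, and ONE compact `C″` with the `hCM`
  clause for ALL `c ∈ U` and the `hint` clause for `c ∈ U` off the wall — the two binders of ★ p850625 at `s := gprimeTorus L α S p` BY NAME) and the census head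
  **`exists_dock_realWall_of_inRegG`** (from a wall point `p₀ ∈ InRegG (slotSign α) S♯`, `x_{w₀} = 0`, semiregular AT `w₀` ONLY, `x_w ≠ 0` on `S`: a semiregular `p`,
  `HcSemireg S w₀ 0 2 p`, whose Cayley point has the `w₀`-coordinates of `p₀`, and the dock above).
HONEST SCOPE: ONE real wall (`w₀`); the other split places of `S♯` stay off their real walls (`x_w ≠ 0`, real CORNERS are (G1), not this file); scalar split points
(`x_{w₀} = 0 ∧ e^{iθ} = e^{iφ}`) are (G3), not this file.  No new analysis: every engine is ★.
HONEST LABEL: HC_CM is proved only modulo the 7 printed citations (2 remaining named inputs: hLiu418 = `stmt-HodgeConjecture-24832`, h413 = `stmt-HodgeConjecture-24833`) until rung 0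
closes; count-neutral (a letter-L1 (I₂) binder discharge; no stub closes by this file alone).

## References
* [Rogawski1990] J. D. Rogawski, *Automorphic Representations of Unitary Groups in Three Variables*, Ann. of Math. Stud. 123 (1990), §4.12 Lemma 4.12.1 p. 66 (the compactness
  lemma), §8.2 p. 114, pp. 118–123 (the walls of `U(2,1)`), §8.3 p. 122, §4.3 p. 43, §3.6 p. 31.
* [HarishChandra1970] Harish-Chandra (notes by G. van Dijk), *Harmonic Analysis on Reductive p-adic Groups*, LNM 162 (1970), Part I §3 Lemma 22.
* [Varadarajan1977] V. S. Varadarajan, *Harmonic Analysis on Real Reductive Groups*, LNM 576 (1977), Part I §1.12 (`'F_f` on `T_{in-reg}`).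
* [Shelstad1979] D. Shelstad, *Characters and inner forms of a quasi-split group over ℝ*, Compositio Math. 39 (1979), §4 pp. 22–25.
* [Bouaziz1994IntegralesOrbitales] A. Bouaziz, *Intégrales orbitales sur les groupes de Lie réductifs*, Ann. Sci. ÉNS 27 (1994), §3.2 p. 580, §6.2 p. 591.
* [DeitmarEchterhoff2014] A. Deitmar, S. Echterhoff, *Principles of Harmonic Analysis*, 2nd ed. (2014), Remark 1.5.2, Lemma 9.3.3.
-/

set_option autoImplicit false

noncomputable section

open MeasureTheory Set Topology NumberField NumberField.InfinitePlace Complex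
open Literature.MeasureTheory.Group Literature.NumberTheory.Automorphic Literature.NumberTheory.Automorphic.UnitaryGroup Literature.NumberTheory.Automorphic.ArchCartan
open scoped MatrixGroups Matrix Pointwise Classical

namespace Literature.NumberTheory.Rogawski1990

/-! ## §1 The simple eigenvalue on `V`; `V` is open -/

section Simple

/-- **On `V` the compact-line eigenvalue of the boost is SIMPLE**: if `x = 0 ⇒ e^{iθ} ≠ e^{iφ}` (`x, φ, θ = cw 0, cw 1, cw 2`), then `boostEig cw 1 = e^{iφ}` differs from
`boostEig cw 0 = e^{x+iθ}` and `boostEig cw 2 = e^{−x+iθ}` — for `x ≠ 0` the boost eigenvalues are pairwise distinct (★ `injective_boostEig_iff`), for `x = 0` this is the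
semiregularity (★ `cexp_mul_I_ne_boostPair`). [cite: Rogawski1990, §8.2 pp. 122–123] [cite: Shelstad1979, §4 p. 22] -/
theorem boostEig_one_ne_of_wall_imp {cw : Fin 3 → ℝ} (h : cw 0 = 0 → Circle.exp (cw 2) ≠ Circle.exp (cw 1)) :
    ∀ j : Fin 3, j ≠ 1 → boostEig cw 1 ≠ boostEig cw j := by
  intro j hj
  by_cases hx : cw 0 = 0
  · have hne := cexp_mul_I_ne_boostPair (h hx) (cw 0)
    fin_cases j
    · exact hne.1
    · exact absurd rfl hj
    · exact hne.2
  · exact fun heq => hj (((injective_boostEig_iff cw).2 hx) heq).symm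

variable (L : Type) [Field L] [NumberField L] (α : Fin 3 → L) (S : Finset {w : InfinitePlace L // IsComplex w}) (w₀ : {w : InfinitePlace L // IsComplex w})

/-- **The dock set `V` is OPEN**: `{c | (c w₀ 0 = 0 → e^{i c w₀ 2} ≠ e^{i c w₀ 1}) ∧ (∀ w ∈ S, c w 0 ≠ 0) ∧ c ∈ InRegG (slotSign α) (insert w₀ S)}` (★ `isOpen_inRegG`).
[cite: Bouaziz1994IntegralesOrbitales, §6.2 p. 591] [cite: Varadarajan1977, I §1.12] -/
theorem isOpen_setOf_wall_imp_inter_inRegG :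
    IsOpen {c : {w : InfinitePlace L // IsComplex w} → Fin 3 → ℝ |
      (c w₀ 0 = 0 → Circle.exp (c w₀ 2) ≠ Circle.exp (c w₀ 1)) ∧ (∀ w, w ∈ S → c w 0 ≠ 0) ∧ c ∈ InRegG (slotSign L α) (insert w₀ S)} := by
  have h1 : IsOpen {c : {w : InfinitePlace L // IsComplex w} → Fin 3 → ℝ | c w₀ 0 = 0 → Circle.exp (c w₀ 2) ≠ Circle.exp (c w₀ 1)} := by
    have he : {c : {w : InfinitePlace L // IsComplex w} → Fin 3 → ℝ | c w₀ 0 = 0 → Circle.exp (c w₀ 2) ≠ Circle.exp (c w₀ 1)} =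
        {c | c w₀ 0 ≠ 0} ∪ {c | Circle.exp (c w₀ 2) ≠ Circle.exp (c w₀ 1)} := by
      ext c
      simp only [mem_setOf_eq, mem_union]
      tauto
    rw [he]
    exact (isOpen_ne_fun ((continuous_apply 0).comp (continuous_apply w₀)) continuous_const).union
      (isOpen_ne_fun (Circle.exp.continuous.comp ((continuous_apply 2).comp (continuous_apply w₀)))
        (Circle.exp.continuous.comp ((continuous_apply 1).comp (continuous_apply w₀))))
  have h2 : IsOpen {c : {w : InfinitePlace L // IsComplex w} → Fin 3 → ℝ | ∀ w, w ∈ S → c w 0 ≠ 0} := by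
    have he : {c : {w : InfinitePlace L // IsComplex w} → Fin 3 → ℝ | ∀ w, w ∈ S → c w 0 ≠ 0} = ⋂ w ∈ S, {c | c w 0 ≠ 0} := by
      ext c; simp only [mem_setOf_eq, mem_iInter]
    rw [he]
    exact isOpen_biInter_finset fun w _ => isOpen_ne_fun ((continuous_apply 0).comp (continuous_apply w)) continuous_const
  exact h1.inter (h2.inter (isOpen_inRegG (slotSign L α) (insert w₀ S)))

end Simple

/-! ## §2 (HYP) modulo `Z(γ_p)` on `V` for the split chart `insert w₀ S`, and the group-level form -/

section Proper

variable (L : Type) [Field L] [NumberField L] [IsCMField L] (α : Fin 3 → L)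
  (S : Finset {w : InfinitePlace L // IsComplex w}) (w₀ : {w : InfinitePlace L // IsComplex w})

/-- **HARISH-CHANDRA'S COMPACTNESS LEMMA FOR THE SPLIT CHART `S ∪ {w₀}` MODULO `Z(γ_p)`, ACROSS THE REAL WALL AT `w₀` AND ACROSS THE COMPACT WALLS ELSEWHERE ((HYP) form).**
`S` admissible, `w₀ ∉ S` a split-chart place, `p` a point of the noncompact wall `p_{w₀,0} = p_{w₀,2}` of the compact chart `S` (`γ_p = gprimeTorus S p` is the Cayley point of the
split chart, ★ `gprimeTorus_of_wall`) which is REGULAR at every other place (`hreg`, `hregS` — (M-UNFOLD)'s binders).  Then `c ↦ gprimeTorus α (insert w₀ S) c` is uniformly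
proper modulo `Z(γ_p)` on `V = {c | (c w₀ 0 = 0 → e^{i c w₀ 2} ≠ e^{i c w₀ 1}) ∧ (∀ w ∈ S, c w 0 ≠ 0) ∧ c ∈ InRegG (slotSign α) (insert w₀ S)}` — compact walls and definite
places INCLUDED. [cite: Rogawski1990, §4.12 Lemma 4.12.1 p. 66; §8.2 pp. 114, 122–123; §4.3 p. 43] [cite: HarishChandra1970, Part I §3 Lemma 22]
[cite: Varadarajan1977, I §1.12] [cite: DeitmarEchterhoff2014, Lemma 9.3.3] -/
theorem uniformlyProper_gprimeTorus_insert_of_wall_inRegG (hα : ∀ i, α i ≠ 0)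
    (hreal : ∀ (w : {w : InfinitePlace L // IsComplex w}) (i : Fin 3), (w.1.embedding (α i)).im = 0)
    (hS : ∀ w, w ∈ S → w ∈ splitChartPlaces L α) (hw₀ : w₀ ∉ S) (hsp : w₀ ∈ splitChartPlaces L α)
    (p : {w : InfinitePlace L // IsComplex w} → Fin 3 → ℝ) (hp : p w₀ 0 = p w₀ 2)
    (hreg : ∀ w, w ≠ w₀ → w ∉ S → Function.Injective fun i : Fin 3 => Circle.exp (p w i)) (hregS : ∀ w, w ∈ S → p w 0 ≠ 0) :
    ∀ K ⊆ {c : {w : InfinitePlace L // IsComplex w} → Fin 3 → ℝ |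
        (c w₀ 0 = 0 → Circle.exp (c w₀ 2) ≠ Circle.exp (c w₀ 1)) ∧ (∀ w, w ∈ S → c w 0 ≠ 0) ∧ c ∈ InRegG (slotSign L α) (insert w₀ S)}, IsCompact K →
      ∀ C' : Set ↥(arch (↥(maximalRealSubfield L)) L (IsCMField.complexConj L) 3 (Matrix.diagonal α)), IsCompact C' →
        ∃ 𝒦' : Set (↥(arch (↥(maximalRealSubfield L)) L (IsCMField.complexConj L) 3 (Matrix.diagonal α)) ⧸
            Subgroup.centralizer ({gprimeTorus L α S p} : Set ↥(arch (↥(maximalRealSubfield L)) L (IsCMField.complexConj L) 3 (Matrix.diagonal α)))),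
          IsCompact 𝒦' ∧ ∀ c ∈ K, ∀ y' : ↥(arch (↥(maximalRealSubfield L)) L (IsCMField.complexConj L) 3 (Matrix.diagonal α)),
            y' * gprimeTorus L α (insert w₀ S) c * y'⁻¹ ∈ C' →
              (QuotientGroup.mk y' : ↥(arch (↥(maximalRealSubfield L)) L (IsCMField.complexConj L) 3 (Matrix.diagonal α)) ⧸
                Subgroup.centralizer ({gprimeTorus L α S p} : Set ↥(arch (↥(maximalRealSubfield L)) L (IsCMField.complexConj L) 3 (Matrix.diagonal α)))) ∈ 𝒦' := by
  have hS' : ∀ w, w ∈ insert w₀ S → w ∈ splitChartPlaces L α := fun w hw =>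
    (Finset.mem_insert.1 hw).elim (fun h => h ▸ hsp) (hS w)
  -- the REGULAR reference point off `w₀`: `c₁ := update p w₀ (1, 0, 0) ∈ RegG (insert w₀ S)`, `c₁ = p` off `w₀`
  set c₁ : {w : InfinitePlace L // IsComplex w} → Fin 3 → ℝ := Function.update p w₀ ![1, 0, 0] with hc₁def
  have hc₁w : ∀ w, w ≠ w₀ → c₁ w = p w := fun w hw => Function.update_of_ne hw _ _
  have hc₁ : c₁ ∈ RegG (insert w₀ S) := by
    rw [mem_regG_iff]
    refine ⟨fun w hw => ?_, fun w hw => ?_⟩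
    · have hww : w ≠ w₀ := fun h => hw (h ▸ Finset.mem_insert_self w₀ S)
      have hwS : w ∉ S := fun h => hw (Finset.mem_insert_of_mem h)
      rw [hc₁w w hww]
      exact hreg w hww hwS
    · rcases Finset.mem_insert.1 hw with rfl | hwS
      · rw [hc₁def, Function.update_self]
        exact one_ne_zero
      · have hww : w ≠ w₀ := fun h => hw₀ (h ▸ hwS)
        rw [hc₁w w hww]
        exact hregS w hwS
  -- the block of `p` at `w₀` on the compact chart IS the split block at the wall point `q := update p w₀ (0, p_{w₀,1}, p_{w₀,0})` (★ `gprimeTorus_of_wall`)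
  have hblk₀ : gprimeBlock L α w₀ S p = gprimeBlock L α w₀ (insert w₀ S) (Function.update p w₀ ![0, p w₀ 1, p w₀ 0]) := by
    have h := congrArg (fun g => archPiEquivCM 3 L (Matrix.diagonal α) g w₀) (gprimeTorus_of_wall L α hw₀ hsp hp)
    simpa only [archPiEquivCM_gprimeTorus] using h
  -- the blocks of `c₁` on the split chart ARE the blocks of `p` on the compact chart, off `w₀`
  have hblk : ∀ w, w ≠ w₀ → gprimeBlock L α w (insert w₀ S) c₁ = gprimeBlock L α w S p := fun w hw => by
    rw [gprimeBlock_insert_of_ne L α S c₁ hw]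
    exact gprimeBlock_congr_place L α S w (hc₁w w hw)
  -- per-place parameter sets
  let T : {w : InfinitePlace L // IsComplex w} → Set (Fin 3 → ℝ) := fun w =>
    {cw | (w = w₀ → ∀ j : Fin 3, j ≠ 1 → boostEig cw 1 ≠ boostEig cw j) ∧
      (w ≠ w₀ → (w ∈ insert w₀ S → cw 0 ≠ 0) ∧
        (w ∉ insert w₀ S → ∀ i j : Fin 3, i ≠ j → slotSign L α w i ≠ slotSign L α w j → Circle.exp (cw i) ≠ Circle.exp (cw j)))}
  -- per-place (HYP) modulo `Z(gprimeBlock w S p)`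
  have hprop : ∀ w : {w : InfinitePlace L // IsComplex w}, ∀ K ⊆ T w, IsCompact K → ∀ C : Set ↥(archLocal L 3 (Matrix.diagonal α) w), IsCompact C →
      ∃ 𝒦 : Set (↥(archLocal L 3 (Matrix.diagonal α) w) ⧸ Subgroup.centralizer ({gprimeBlock L α w S p} : Set ↥(archLocal L 3 (Matrix.diagonal α) w))),
        IsCompact 𝒦 ∧ ∀ cw ∈ K, ∀ y : ↥(archLocal L 3 (Matrix.diagonal α) w), y * gprimeBlock L α w (insert w₀ S) (fun _ => cw) * y⁻¹ ∈ C →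
          (QuotientGroup.mk y : ↥(archLocal L 3 (Matrix.diagonal α) w) ⧸ Subgroup.centralizer ({gprimeBlock L α w S p} : Set ↥(archLocal L 3 (Matrix.diagonal α) w))) ∈ 𝒦 := by
    intro w
    by_cases hw : w = w₀
    · subst hw
      -- at `w₀`: the split block chart across its real wall, modulo `Stab(e_{τ1}) ≤ Z(block of p)`
      have hM : MulAction.stabilizer ↥(archLocal L 3 (Matrix.diagonal α) w) (Pi.single (lineOf (formSign L α w) 1) (1 : ℂ) : Fin 3 → ℂ) ≤
          Subgroup.centralizer ({gprimeBlock L α w S p} : Set ↥(archLocal L 3 (Matrix.diagonal α) w)) := by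
        rw [hblk₀]
        exact stabilizer_single_le_centralizer_gprimeBlock_split_of_wall L α (insert w S) hα (Finset.mem_insert_self w S) hsp _
          (by rw [Function.update_self]; rfl)
      exact uniformlyProper_mono _ _ (fun cw hcw => hcw.1 rfl)
        (uniformlyProper_gprimeBlock_split_of_ne L α (insert w S) hα (Finset.mem_insert_self w S) hsp _ hM)
    · -- off `w₀`: the whole `w`-factor of `InRegG ∩ {x ≠ 0}` modulo `Z(gprimeBlock c₁) = Z(gprimeBlock p)` (★ p850547)
      have h := uniformlyProper_gprimeBlock_of_inRegG_place L α (insert w₀ S) hα hreal hS' hc₁ w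
      rw [hblk w hw] at h
      exact uniformlyProper_mono _ _ (fun cw hcw => hcw.2 hw) h
  -- assembly over the places
  intro K hK hKc C' hC'
  have hKT : K ⊆ Set.pi Set.univ T := by
    intro c hc w _
    refine ⟨fun hw => ?_, fun hw => ⟨fun hwS => ?_, fun hwS => ?_⟩⟩
    · subst hw
      exact boostEig_one_ne_of_wall_imp (hK hc).1
    · exact (hK hc).2.1 w (Finset.mem_of_mem_insert_of_ne hwS hw)
    · exact (hK hc).2.2 w hwS
  obtain ⟨𝒦', h𝒦', hmem⟩ := uniformlyProper_arch_of_places L 3 (Matrix.diagonal α)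
    (fun w => Subgroup.centralizer ({gprimeBlock L α w S p} : Set ↥(archLocal L 3 (Matrix.diagonal α) w)))
    (Subgroup.centralizer ({gprimeTorus L α S p} : Set _)) (symm_archPiEquivCM_mem_centralizer_gprimeTorus_iff L α S p)
    (fun w cw => gprimeBlock L α w (insert w₀ S) (fun _ => cw)) T hprop K hKT hKc C' hC'
  exact ⟨𝒦', h𝒦', fun c hc y' hy' => hmem c hc y' (by rwa [gprimeTorus_eq_symm_blockChart] at hy')⟩

/-- **Group-level form** — the uniform `hCM` binder of ★ D4b `chartOrbG_eq_integral_descended_of_cutoff` ∕ ★ p850625 at `s := γ_p`: for `K ⊆ V` compact and `C′ ⊆ G′_∞` compact,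
ONE compact `C″` with `y′ ∈ C″ · Z(γ_p)` whenever `y′ · gprimeTorus (insert w₀ S) c · y′⁻¹ ∈ C′` for some `c ∈ K` (compact sets of `G′_∞ ⧸ Z(γ_p)` lift, ★
`exists_isCompact_image_mk_superset`). [cite: Rogawski1990, §4.12 Lemma 4.12.1 p. 66; §8.2 p. 114] [cite: HarishChandra1970, Part I §3 Lemma 22] [cite: DeitmarEchterhoff2014, Remark 1.5.2] -/
theorem exists_isCompact_mul_gprimeTorus_insert_of_wall_inRegG (hα : ∀ i, α i ≠ 0)
    (hreal : ∀ (w : {w : InfinitePlace L // IsComplex w}) (i : Fin 3), (w.1.embedding (α i)).im = 0)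
    (hS : ∀ w, w ∈ S → w ∈ splitChartPlaces L α) (hw₀ : w₀ ∉ S) (hsp : w₀ ∈ splitChartPlaces L α)
    (p : {w : InfinitePlace L // IsComplex w} → Fin 3 → ℝ) (hp : p w₀ 0 = p w₀ 2)
    (hreg : ∀ w, w ≠ w₀ → w ∉ S → Function.Injective fun i : Fin 3 => Circle.exp (p w i)) (hregS : ∀ w, w ∈ S → p w 0 ≠ 0)
    {K : Set ({w : InfinitePlace L // IsComplex w} → Fin 3 → ℝ)}
    (hKV : K ⊆ {c : {w : InfinitePlace L // IsComplex w} → Fin 3 → ℝ |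
        (c w₀ 0 = 0 → Circle.exp (c w₀ 2) ≠ Circle.exp (c w₀ 1)) ∧ (∀ w, w ∈ S → c w 0 ≠ 0) ∧ c ∈ InRegG (slotSign L α) (insert w₀ S)})
    (hK : IsCompact K) {C' : Set ↥(arch (↥(maximalRealSubfield L)) L (IsCMField.complexConj L) 3 (Matrix.diagonal α))} (hC' : IsCompact C') :
    ∃ C'' : Set ↥(arch (↥(maximalRealSubfield L)) L (IsCMField.complexConj L) 3 (Matrix.diagonal α)), IsCompact C'' ∧
      ∀ c ∈ K, ∀ y' : ↥(arch (↥(maximalRealSubfield L)) L (IsCMField.complexConj L) 3 (Matrix.diagonal α)),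
        y' * gprimeTorus L α (insert w₀ S) c * y'⁻¹ ∈ C' →
          y' ∈ C'' * (Subgroup.centralizer ({gprimeTorus L α S p} : Set ↥(arch (↥(maximalRealSubfield L)) L (IsCMField.complexConj L) 3 (Matrix.diagonal α))) :
            Set ↥(arch (↥(maximalRealSubfield L)) L (IsCMField.complexConj L) 3 (Matrix.diagonal α))) := by
  obtain ⟨𝒦', h𝒦', hmem⟩ := uniformlyProper_gprimeTorus_insert_of_wall_inRegG L α S w₀ hα hreal hS hw₀ hsp p hp hreg hregS K hKV hK C' hC'
  obtain ⟨C'', hC'', hsub⟩ := exists_isCompact_image_mk_superset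
    (Subgroup.centralizer ({gprimeTorus L α S p} : Set ↥(arch (↥(maximalRealSubfield L)) L (IsCMField.complexConj L) 3 (Matrix.diagonal α)))) h𝒦'
  refine ⟨C'', hC'', fun c hc y' hy' => ?_⟩
  obtain ⟨a, ha, hay⟩ := hsub (hmem c hc y' hy')
  rw [QuotientGroup.eq] at hay
  exact ⟨a, ha, a⁻¹ * y', hay, by group⟩

end Proper

/-! ## §3 The chart integrand is integrable at every point of `{∀ w ∈ S′, x_w ≠ 0} ∩ InRegG` (the `hint` binder, compact walls included) -/

section Integrable

variable (L : Type) [Field L] [NumberField L] [IsCMField L] (α : Fin 3 → L) (S' : Finset {w : InfinitePlace L // IsComplex w})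

/-- **THE `Integrable` BINDER OF ★ D4b AT EVERY POINT OF `{∀ w ∈ S′, x_w ≠ 0} ∩ InRegG (slotSign α) S′`** (any admissible `S′`; compact walls and definite places INCLUDED): for
`a′ ∈ C_c(G′_∞)` and any measure on `G′_∞ ⧸ T_{S′}` finite on compact sets, `descConj (gprimeTorus S′ c) T_{S′} a′` is integrable — (HYP) modulo `T_{S′}` at the point (★ p850547
`uniformlyProper_gprimeTorus_chartTorusG_inRegG`) makes the integrand `C_c` on `G′_∞ ⧸ T_{S′}` (★ D3 §1 `integrable_descConj_of_exists_isCompact`).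
[cite: Rogawski1990, §8.3 p. 122; §4.12 Lemma 4.12.1 p. 66] [cite: Varadarajan1977, I §1.12] [cite: DeitmarEchterhoff2014, Lemma 9.3.3] -/
theorem integrable_descConj_gprimeTorus_of_inRegG (hα : ∀ i, α i ≠ 0)
    (hreal : ∀ (w : {w : InfinitePlace L // IsComplex w}) (i : Fin 3), (w.1.embedding (α i)).im = 0)
    (hS' : ∀ w, w ∈ S' → w ∈ splitChartPlaces L α)
    {c : {w : InfinitePlace L // IsComplex w} → Fin 3 → ℝ} (hc : (∀ w, w ∈ S' → c w 0 ≠ 0) ∧ c ∈ InRegG (slotSign L α) S')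
    {E : Type*} [NormedAddCommGroup E] [NormedSpace ℝ E] {a' : ↥(arch (↥(maximalRealSubfield L)) L (IsCMField.complexConj L) 3 (Matrix.diagonal α)) → E}
    (ha'c : Continuous a') (ha's : HasCompactSupport a')
    [MeasurableSpace (↥(arch (↥(maximalRealSubfield L)) L (IsCMField.complexConj L) 3 (Matrix.diagonal α)) ⧸ chartTorusG L α S')]
    [OpensMeasurableSpace (↥(arch (↥(maximalRealSubfield L)) L (IsCMField.complexConj L) 3 (Matrix.diagonal α)) ⧸ chartTorusG L α S')]
    (μ : Measure (↥(arch (↥(maximalRealSubfield L)) L (IsCMField.complexConj L) 3 (Matrix.diagonal α)) ⧸ chartTorusG L α S')) [IsFiniteMeasureOnCompacts μ] :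
    Integrable (descConj (gprimeTorus L α S' c) (chartTorusG L α S') (forall_mem_chartTorusG_comm L α S' c) a') μ := by
  have hK : ({c} : Set ({w : InfinitePlace L // IsComplex w} → Fin 3 → ℝ)) ⊆
      {c : {w : InfinitePlace L // IsComplex w} → Fin 3 → ℝ | (∀ w, w ∈ S' → c w 0 ≠ 0) ∧ c ∈ InRegG (slotSign L α) S'} := by
    intro x hx
    rw [mem_singleton_iff.1 hx]
    exact hc
  obtain ⟨𝒦, h𝒦, hmem⟩ := uniformlyProper_gprimeTorus_chartTorusG_inRegG L α S' hα hreal hS' {c} hK isCompact_singleton (tsupport a') ha's.isCompact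
  exact integrable_descConj_of_exists_isCompact (chartTorusG L α S') (isClosed_chartTorusG L α S') (gprimeTorus L α S' c)
    (forall_mem_chartTorusG_comm L α S' c) ha'c h𝒦 (fun y hy => hmem c (mem_singleton c) y hy) μ

end Integrable

/-! ## §4 The docks: the `hCM` ∕ `hint` binders of ★ p850625 ∕ ★ p850781 on a neighbourhood of ANY point of `V` -/

section Dock

variable (L : Type) [Field L] [NumberField L] [IsCMField L] (α : Fin 3 → L)
  [MeasurableSpace ↥(arch (↥(maximalRealSubfield L)) L (IsCMField.complexConj L) 3 (Matrix.diagonal α))]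
  [BorelSpace ↥(arch (↥(maximalRealSubfield L)) L (IsCMField.complexConj L) 3 (Matrix.diagonal α))]
  (ν' : Measure ↥(arch (↥(maximalRealSubfield L)) L (IsCMField.complexConj L) 3 (Matrix.diagonal α))) [ν'.IsHaarMeasure] [ν'.IsMulRightInvariant]
  (S : Finset {w : InfinitePlace L // IsComplex w}) (w₀ : {w : InfinitePlace L // IsComplex w})

/-- **THE DOCK NEAR ANY POINT OF `V`, in (M-UNFOLD)'s currency.**  `S` admissible, `w₀ ∉ S` a split-chart place, `p` the compact-chart wall point (`p w₀ 0 = p w₀ 2`) regular at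
every other place (`hreg`, `hregS`), `a′ ∈ C_c(G′_∞)`.  Every `p₀ ∈ V` has an open neighbourhood `U ⊆ V` and ONE compact `C″ ⊆ G′_∞` such that
(`hCM`, for ALL `c ∈ U`, the wall included) `y′ · gprimeTorus (insert w₀ S) c · y′⁻¹ ∈ tsupport a′ ⇒ y′ ∈ C″ · Z(gprimeTorus S p)`, and (`hint`, for `c ∈ U` off the wall
`x_{w₀} ≠ 0`) the chart integrand `descConj (gprimeTorus (insert w₀ S) c) T a′` is integrable for `chartQuotientMeasureG` — the two binders of ★ p850625
`continuousOn_orbFamGExt_realWall_descended_of_cutoff` ∕ ★ D4b `chartOrbG_eq_integral_descended_of_cutoff` at `s := gprimeTorus L α S p`, at a general real-wall point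
(compact walls at the other places allowed). [cite: Rogawski1990, §4.12 Lemma 4.12.1 p. 66; §8.2 pp. 114, 122–123; §8.3 p. 122] [cite: HarishChandra1970, Part I §3 Lemma 22]
[cite: Varadarajan1977, I §1.12] [cite: Shelstad1979, §4 p. 25] -/
theorem exists_nhds_realWall_dock (hα : ∀ i, α i ≠ 0)
    (hreal : ∀ (w : {w : InfinitePlace L // IsComplex w}) (i : Fin 3), (w.1.embedding (α i)).im = 0)
    (hS : ∀ w, w ∈ S → w ∈ splitChartPlaces L α) (hw₀ : w₀ ∉ S) (hsp : w₀ ∈ splitChartPlaces L α)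
    (p : {w : InfinitePlace L // IsComplex w} → Fin 3 → ℝ) (hp : p w₀ 0 = p w₀ 2)
    (hreg : ∀ w, w ≠ w₀ → w ∉ S → Function.Injective fun i : Fin 3 => Circle.exp (p w i)) (hregS : ∀ w, w ∈ S → p w 0 ≠ 0)
    {p₀ : {w : InfinitePlace L // IsComplex w} → Fin 3 → ℝ}
    (hp₀ : p₀ ∈ {c : {w : InfinitePlace L // IsComplex w} → Fin 3 → ℝ |
        (c w₀ 0 = 0 → Circle.exp (c w₀ 2) ≠ Circle.exp (c w₀ 1)) ∧ (∀ w, w ∈ S → c w 0 ≠ 0) ∧ c ∈ InRegG (slotSign L α) (insert w₀ S)})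
    {a' : ↥(arch (↥(maximalRealSubfield L)) L (IsCMField.complexConj L) 3 (Matrix.diagonal α)) → ℂ} (ha'c : Continuous a') (ha's : HasCompactSupport a') :
    ∃ U : Set ({w : InfinitePlace L // IsComplex w} → Fin 3 → ℝ), IsOpen U ∧ p₀ ∈ U ∧
      U ⊆ {c : {w : InfinitePlace L // IsComplex w} → Fin 3 → ℝ |
        (c w₀ 0 = 0 → Circle.exp (c w₀ 2) ≠ Circle.exp (c w₀ 1)) ∧ (∀ w, w ∈ S → c w 0 ≠ 0) ∧ c ∈ InRegG (slotSign L α) (insert w₀ S)} ∧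
      ∃ C'' : Set ↥(arch (↥(maximalRealSubfield L)) L (IsCMField.complexConj L) 3 (Matrix.diagonal α)), IsCompact C'' ∧
        (∀ c ∈ U, ∀ y' : ↥(arch (↥(maximalRealSubfield L)) L (IsCMField.complexConj L) 3 (Matrix.diagonal α)),
          y' * gprimeTorus L α (insert w₀ S) c * y'⁻¹ ∈ tsupport a' →
            y' ∈ C'' * (Subgroup.centralizer ({gprimeTorus L α S p} : Set ↥(arch (↥(maximalRealSubfield L)) L (IsCMField.complexConj L) 3 (Matrix.diagonal α))) :
              Set ↥(arch (↥(maximalRealSubfield L)) L (IsCMField.complexConj L) 3 (Matrix.diagonal α)))) ∧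
        (∀ c ∈ U, c w₀ 0 ≠ 0 → Integrable (descConj (gprimeTorus L α (insert w₀ S) c) (chartTorusG L α (insert w₀ S)) (forall_mem_chartTorusG_comm L α (insert w₀ S) c) a')
          (chartQuotientMeasureG L α ν' (insert w₀ S))) := by
  have hS' : ∀ w, w ∈ insert w₀ S → w ∈ splitChartPlaces L α := fun w hw =>
    (Finset.mem_insert.1 hw).elim (fun h => h ▸ hsp) (hS w)
  -- a compact neighbourhood `K` of `p₀` inside the open `V`; `U := interior K`
  obtain ⟨K, hKc, hp₀K, hKV⟩ := exists_compact_subset (isOpen_setOf_wall_imp_inter_inRegG L α S w₀) hp₀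
  obtain ⟨C'', hC'', hmem⟩ := exists_isCompact_mul_gprimeTorus_insert_of_wall_inRegG L α S w₀ hα hreal hS hw₀ hsp p hp hreg hregS hKV hKc ha's.isCompact
  refine ⟨interior K, isOpen_interior, hp₀K, interior_subset.trans hKV, C'', hC'', fun c hc y' hy' => hmem c (interior_subset hc) y' hy', fun c hc hx => ?_⟩
  -- `hint`: the point lies in `{∀ w ∈ insert w₀ S, x_w ≠ 0} ∩ InRegG` (§3)
  letI : MeasurableSpace (↥(arch (↥(maximalRealSubfield L)) L (IsCMField.complexConj L) 3 (Matrix.diagonal α)) ⧸ chartTorusG L α (insert w₀ S)) := borel _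
  haveI : BorelSpace (↥(arch (↥(maximalRealSubfield L)) L (IsCMField.complexConj L) 3 (Matrix.diagonal α)) ⧸ chartTorusG L α (insert w₀ S)) := ⟨rfl⟩
  haveI := isMulLeftInvariant_chartHaarG L α (insert w₀ S)
  haveI := isFiniteMeasureOnCompacts_chartHaarG L α (insert w₀ S)
  haveI := isOpenPosMeasure_chartHaarG L α (insert w₀ S)
  haveI := isInvInvariant_chartHaarG L α (insert w₀ S)
  have hq : chartQuotientMeasureG L α ν' (insert w₀ S) =
      quotientMeasure (chartTorusG L α (insert w₀ S)) (chartHaarG L α (insert w₀ S)) (isClosed_chartTorusG L α (insert w₀ S)) ν' := rfl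
  haveI : IsFiniteMeasureOnCompacts (chartQuotientMeasureG L α ν' (insert w₀ S)) := by rw [hq]; infer_instance
  have hcV := hKV (interior_subset hc)
  refine integrable_descConj_gprimeTorus_of_inRegG L α (insert w₀ S) hα hreal hS' ⟨fun w hw => ?_, hcV.2.2⟩ ha'c ha's _
  rcases Finset.mem_insert.1 hw with rfl | hwS
  · exact hx
  · exact hcV.2.1 w hwS

/-- **(G2) «REAL WALL × COMPACT WALLS DOCK» — THE CENSUS HEAD.**  `S` admissible, `w ∉ S` a split-chart place, `p₀` a point of the REAL WALL `x_w = 0` of the split chart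
`insert w S` lying in `InRegG (slotSign α) (insert w S)` (so at the compact-chart places ONLY the noncompact walls are excluded — `p₀` may sit on compact walls there, or anywhere at a
definite place), semiregular AT `w` (`e^{iθ_w} ≠ e^{iφ_w}`) and off the real walls of `S` (`hoff`).  Then there is a SEMIREGULAR compact-chart wall point `p₁` (`HcSemireg S w 0 2 p₁`:
(M-UNFOLD) ∕ ★ D4b apply verbatim at `s := gprimeTorus S p₁`) whose Cayley point has the `w`-coordinates of `p₀` (`hcCayPt w 0 2 p₁ w = p₀ w`: the same `U(1,1)`-block), an open
`U ∋ p₀` inside `V`, and ONE compact `C″` carrying the `hCM` clause on all of `U` and the `hint` clause on `U ∩ {x_w ≠ 0}` (★ `exists_nhds_realWall_dock`; `p₁ := p₀`'s wall data at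
`w`, `p₀` at the places of `S`, a regular point at the compact-chart places, ★ `dense_regG`). [cite: Rogawski1990, §4.12 Lemma 4.12.1 p. 66; §8.2 pp. 114, 122–123; §8.3 p. 122]
[cite: HarishChandra1970, Part I §3 Lemma 22] [cite: Varadarajan1977, I §1.12] [cite: Shelstad1979, §4 pp. 22–25] [cite: Bouaziz1994IntegralesOrbitales, §3.2 p. 580; §6.2 p. 591] -/
theorem exists_dock_realWall_of_inRegG (hα : ∀ i, α i ≠ 0)
    (hreal : ∀ (w : {w : InfinitePlace L // IsComplex w}) (i : Fin 3), (w.1.embedding (α i)).im = 0)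
    (hS : ∀ w', w' ∈ S → w' ∈ splitChartPlaces L α) {w : {w : InfinitePlace L // IsComplex w}} (hw : w ∉ S) (hsp : w ∈ splitChartPlaces L α)
    {p₀ : {w : InfinitePlace L // IsComplex w} → Fin 3 → ℝ} (hp₀ : p₀ ∈ InRegG (slotSign L α) (insert w S)) (hx : p₀ w 0 = 0)
    (hsr : Circle.exp (p₀ w 2) ≠ Circle.exp (p₀ w 1)) (hoff : ∀ w', w' ∈ S → p₀ w' 0 ≠ 0)
    {a' : ↥(arch (↥(maximalRealSubfield L)) L (IsCMField.complexConj L) 3 (Matrix.diagonal α)) → ℂ} (ha'c : Continuous a') (ha's : HasCompactSupport a') :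
    ∃ p₁ : {w : InfinitePlace L // IsComplex w} → Fin 3 → ℝ, HcSemireg S w 0 2 p₁ ∧ hcCayPt w 0 2 p₁ w = p₀ w ∧
      ∃ U : Set ({w : InfinitePlace L // IsComplex w} → Fin 3 → ℝ), IsOpen U ∧ p₀ ∈ U ∧
        U ⊆ {c : {w : InfinitePlace L // IsComplex w} → Fin 3 → ℝ |
          (c w 0 = 0 → Circle.exp (c w 2) ≠ Circle.exp (c w 1)) ∧ (∀ w', w' ∈ S → c w' 0 ≠ 0) ∧ c ∈ InRegG (slotSign L α) (insert w S)} ∧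
        ∃ C'' : Set ↥(arch (↥(maximalRealSubfield L)) L (IsCMField.complexConj L) 3 (Matrix.diagonal α)), IsCompact C'' ∧
          (∀ c ∈ U, ∀ y' : ↥(arch (↥(maximalRealSubfield L)) L (IsCMField.complexConj L) 3 (Matrix.diagonal α)),
            y' * gprimeTorus L α (insert w S) c * y'⁻¹ ∈ tsupport a' →
              y' ∈ C'' * (Subgroup.centralizer ({gprimeTorus L α S p₁} : Set ↥(arch (↥(maximalRealSubfield L)) L (IsCMField.complexConj L) 3 (Matrix.diagonal α))) :
                Set ↥(arch (↥(maximalRealSubfield L)) L (IsCMField.complexConj L) 3 (Matrix.diagonal α)))) ∧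
          (∀ c ∈ U, c w 0 ≠ 0 → Integrable (descConj (gprimeTorus L α (insert w S) c) (chartTorusG L α (insert w S)) (forall_mem_chartTorusG_comm L α (insert w S) c) a')
            (chartQuotientMeasureG L α ν' (insert w S))) := by
  -- a regular point, used at the compact-chart places only
  obtain ⟨c₁, hc₁⟩ := (dense_regG (insert w S)).nonempty
  have hc₁reg := ((mem_regG_iff (insert w S) c₁).1 hc₁).1
  -- the compact-chart wall point: `(θ, φ, θ)` at `w` (so that its Cayley point reads `(0, φ, θ) = p₀ w`), `p₀` on `S`, `c₁` at the compact-chart places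
  set p₁ : {w : InfinitePlace L // IsComplex w} → Fin 3 → ℝ :=
    fun w' => if w' = w then ![p₀ w 2, p₀ w 1, p₀ w 2] else if w' ∈ S then p₀ w' else c₁ w' with hp₁def
  have hp₁w : p₁ w = ![p₀ w 2, p₀ w 1, p₀ w 2] := by simp [hp₁def]
  have hp₁S : ∀ w', w' ∈ S → p₁ w' = p₀ w' := fun w' hw' => by
    have hne : w' ≠ w := fun h => hw (h ▸ hw')
    simp [hp₁def, hne, hw']
  have hp₁c : ∀ w', w' ≠ w → w' ∉ S → p₁ w' = c₁ w' := fun w' hw' hwS => by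
    simp [hp₁def, hw', hwS]
  have hp : p₁ w 0 = p₁ w 2 := by rw [hp₁w]; rfl
  have h10 : Circle.exp (p₁ w 1) ≠ Circle.exp (p₁ w 0) := by
    rw [hp₁w]
    exact hsr.symm
  have hreg : ∀ w', w' ≠ w → w' ∉ S → Function.Injective fun i : Fin 3 => Circle.exp (p₁ w' i) := fun w' hw' hwS => by
    rw [hp₁c w' hw' hwS]
    exact hc₁reg w' (fun h => (Finset.mem_insert.1 h).elim hw' hwS)
  have hregS : ∀ w', w' ∈ S → p₁ w' 0 ≠ 0 := fun w' hw' => by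
    rw [hp₁S w' hw']
    exact hoff w' hw'
  have hsemi : HcSemireg S w 0 2 p₁ := ⟨hp, by rw [hcThird_zero_two]; exact h10, fun w' hwS hw' => hreg w' hw' hwS, hregS⟩
  have hcay : hcCayPt w 0 2 p₁ w = p₀ w := by
    rw [hcCayPt_eq_of_wall hp, Function.update_self, hcThird_zero_two, hp₁w]
    funext k
    fin_cases k
    · exact hx.symm
    · rfl
    · rfl
  obtain ⟨U, hU, hp₀U, hUV, C'', hC'', hCM, hint⟩ :=
    exists_nhds_realWall_dock L α ν' S w hα hreal hS hw hsp p₁ hp hreg hregS (p₀ := p₀) ⟨fun _ => hsr, hoff, hp₀⟩ ha'c ha's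
  exact ⟨p₁, hsemi, hcay, U, hU, hp₀U, hUV, C'', hC'', hCM, hint⟩

end Dock

end Literature.NumberTheory.Rogawski1990

end
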